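import Summits.Schanuel.Schanuel.Theses.DiophantineDichotomy
import Literature.NumberTheory.Transcendental.NesterenkoEliminationFacts

/-!
# Line `orbit-interpolation-determinant` — crux `ApproximationProperty` (stmt-Schanuel-6117)

Checked skeleton (crux-plan seat `planner-cruxplan-stmt-Schanuel-6117-orbit-interpolation--0`,
2026-08-16) for the idea card `Cruxes/ApproximationProperty/Ideas/orbit-interpolation-determinant.md`
(Galois-orbit Vandermonde: a `t`-dimensional Lemma A.8 turns Philippon's close 0-cycle into a close
point), sharpened by the triage panel TRIAGE-r1-{1,2,3}.

## Shape (reshaped by the line lead prover-line-stmt-Schanuel-6117-0, 2026-08-16: the cycle input split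
`t = 1` (Dirichlet, provable) / `t ≥ 2` (printed for `t ≤ 3` modulo construction data, conjecture for
`t ≥ 4`; unstaffed); the 0-dimensional dictionary registered as its own stub `stub_zeroDimDictionary`
and taken as a HYPOTHESIS by stubs 4–5; stubs 5–6 SLICED by dimension so that every landed stub closes
a slice; composition unchanged in substance)

Seven registered stubs `stub_*` (sorried) and the kernel-checked composition
`ApproximationProperty_of : DiophantineDichotomy.ApproximationProperty` (no hypotheses; the stubs
are invoked). The chain, with the intermediate statements defined in this file:

  `CycleAPIAt t` (0-cycle approximation property WITH interpolation control at the points of `ℂᵗ`,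
  Nesterenko's elimination language `Rx t`, `ideg`, `iheight`, `iabs`; stubs 1–2, split `t ≤ 3` /
  `4 ≤ t`)
  ⟶ [`OrbitClusterBound` (THE LEVER, stub 3) ⟹ `SharpClosestPoint` = the card's transfer `C⁺`
  (stub 4)]
  ⟶ `PointAPAbs` (point approximation property at the points of `ℂᵗ` in the PROJECTIVE / Weil
  currency `([K:ℚ], [K:ℚ]·h(1:β))`, stub 5)
  ⟶ `PointwiseAP` (= the crux, verbatim, factored through the standing disprover's `APAt`; stub 6 is
  the lifting / currency step the triage asked to be done "from `(d(α), h(1:α))`")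
  ⟶ `ApproximationProperty` by `Iff.rfl`.

## Disproof.lean obligations honoured (cdisprove seat, rev. 2026-08-16)

* `approximationProperty_false_without_pos_t` (§1, landed as `…ApproximationPropertyShape.
  false_without_pos_t`): `1 ≤ t` is carried by EVERY intermediate statement (`CycleAPIAt`,
  `PointAPAbs`, `PointwiseAP`) and is used in `stub_lift` (degree budget `(cΔ)ᵗ ≥ cΔ ≥ d` needs
  `t ≥ 1`) and in `stub_orbitClusterBound` (the filling exponent `k^{1+1/t}`).
* `approximationProperty_uniform_false` (§2, landed as `….false_with_uniform_constant`): every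
  constant is chosen AFTER the point (`∀ ω, ∃ c`), and `SharpClosestPoint` carries the explicit
  `log (2 + ‖ω‖)` term through which `c(θ) ≳ log⁺ ‖θ‖` enters (`stub_pointAP` absorbs it by a
  height-scale boost `λ(‖ω‖)·Y`).
* `apScaleExponentDegOne_false` / `not_apScaleWith_liouville` / `repulsion` (§3, landed as
  `…ApproximationPropertyScaleExponentLiouville.*`): every accuracy below is OUTPUT-dependent —
  `exp(−(Δ·iheight + Y·ideg)/c)` for cycles, `exp(−(Δ·logHeight + Y·finrank)/c)` for points; no
  stub implies the refuted scale-exponent form `APScaleExponentDegOne`.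
* §4 (`apAt_of_forall_isAlgebraic`): the `trdeg = 0` instances are discharged inside `stub_lift`
  with `γ = θ` (re-proved there; Disproof.lean is not importable).
* `ledger negatives --problem Schanuel` (2026-08-16): the two PolarPhantoms refutations only; no
  stub is an instance of a refuted statement.
-/

set_option linter.dupNamespace false

namespace Summit.Schanuel.Schanuel.Cruxes.ApproximationProperty.OrbitInterpolationDeterminant

open Summit.Schanuel.Schanuel.Theses.DiophantineDichotomy
open Literature.NumberTheory.Transcendental.Nesterenko MvPolynomial
open scoped BigOperators

attribute [local instance] MvPolynomial.gradedAlgebra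

noncomputable section

/-! ## §0  The crux, pointwise (verbatim from `Cruxes/ApproximationProperty/Disproof.lean` §0) -/

/-- The approximation DATUM of the crux, literally its matrix: `γ` approximates `θ` at scale
`(Δ, Y)` with certified joint degree `d`, naive height `H`, dimension exponent `t`, constant `c`.
[Disproof.lean §0, verbatim] -/
def APDatum {ι : Type} [Fintype ι] (θ : ι → ℂ) (t : ℕ) (c Δ Y : ℝ) (γ : ι → ℂ) (d H : ℕ) :
    Prop :=
  Module.finrank ℚ ↥(IntermediateField.adjoin ℚ (Set.range γ)) ≤ d ∧
  (∀ i, ∃ P : Polynomial ℤ, P ≠ 0 ∧ P.natDegree ≤ d ∧ (∀ k, |P.coeff k| ≤ (H : ℤ)) ∧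
    Polynomial.aeval (γ i) P = 0) ∧
  (d : ℝ) ≤ (c * Δ) ^ t ∧ Real.log H ≤ c * Y * Δ ^ (t - 1) ∧
  ‖γ - θ‖ ≤ Real.exp (-((Real.log H * Δ + d * Y) / c))

/-- The approximation property AT `θ`, exponent `t`, with a GIVEN constant `c`.
[Disproof.lean §0, verbatim] -/
def APWith {ι : Type} [Fintype ι] (θ : ι → ℂ) (t : ℕ) (c : ℝ) : Prop :=
  ∀ Δ Y : ℝ, c ≤ Δ → Δ ≤ Y → ∃ (γ : ι → ℂ) (d H : ℕ), APDatum θ t c Δ Y γ d H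

/-- The approximation property AT `θ` with exponent `t` (some constant `c ≥ 1`).
[Disproof.lean §0, verbatim] -/
def APAt {ι : Type} [Fintype ι] (θ : ι → ℂ) (t : ℕ) : Prop :=
  ∃ c : ℝ, 1 ≤ c ∧ APWith θ t c

/-- The crux, factored pointwise: "`1 ≤ t` and `trdeg_ℚ ℚ(θ) ≤ t` imply `APAt θ t`". This is the
CONCLUSION of the last stub (`stub_lift`); it is the crux by `Iff.rfl` (`pointwiseAP_iff`), kept
under its own name so that only `ApproximationProperty_of` concludes the route decl by name. -/
def PointwiseAP : Prop :=
  ∀ (ι : Type) [Fintype ι] (θ : ι → ℂ) (t : ℕ), 1 ≤ t →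
    Algebra.trdeg ℚ ↥(IntermediateField.adjoin ℚ (Set.range θ)) ≤ (t : Cardinal) → APAt θ t

/-- `PointwiseAP` is the crux, verbatim (cf. Disproof.lean `approximationProperty_iff`). -/
theorem pointwiseAP_iff : PointwiseAP ↔ ApproximationProperty := Iff.rfl

/-- The crux at a FIXED exponent `t` (all finite `ι`, all `θ` with `trdeg ℚ(θ) ≤ t`): the slice that
the sliced stubs 5–6 close dimension by dimension (lead's reshape). `PointwiseAPSlice 1` is the route's
support item `ApproximationPropertyDegOne` up to `(cΔ)^1 = cΔ`, `Δ^0 = 1` (`degOne_of_slice_one`). -/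
def PointwiseAPSlice (t : ℕ) : Prop :=
  ∀ (ι : Type) [Fintype ι] (θ : ι → ℂ),
    Algebra.trdeg ℚ ↥(IntermediateField.adjoin ℚ (Set.range θ)) ≤ (t : Cardinal) → APAt θ t

/-- The crux is the conjunction of its slices over `t ≥ 1` (pure logic). -/
theorem pointwiseAP_iff_slice : PointwiseAP ↔ ∀ t : ℕ, 1 ≤ t → PointwiseAPSlice t :=
  ⟨fun h t ht ι _ θ hθ => h ι θ t ht hθ, fun h ι _ θ t ht hθ => h t ht ι θ hθ⟩

/-! ## §1  Input: the 0-cycle approximation property WITH interpolation control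

Philippon's APPROXIMATION PROPERTY 1 with `d' = 0` (LNM 1752 Ch. 4 §4, PDF p. 61: a 0-dimensional
`ℚ`-cycle `Z` close to `x` with `deg Z ≤ (cΔ)ⁿ`, `h(Z) ≤ cⁿ H Δⁿ⁻¹`,
`log Dist(x, Z) ≤ −c⁻ⁿ (h(Z) Δ + deg Z · H)`; "verified when `d' ∈ {n−3, …, n}`", i.e. PRINTED for
`n ≤ 3` [Philippon2000 = doi:10.1006/jnth.1999.2461, acq-02318], Philippon's CONJECTURE for
`n ≥ 4`), written for the affine points `ω̄ = (1 : ω)`, `ω ∈ ℂᵗ`, in the tree's Nesterenko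
language (`|I(ω̄)|` = `iabs I 1 ω̄` replaces `Dist`, `h(I)` = `iheight I 1`, `deg I` = `ideg I 1`;
for 0-dimensional cycles these agree with Philippon's up to `e^{O(t² deg)}`, absorbed by `c` and
`Y ≥ Δ`), PLUS the construction datum every extraction card needs (TRIAGE-r1-2 sharpen on this
card; TRIAGE-r1-3 on orbit-concentration): every component orbit of the cycle imposes independent
conditions on forms of degree `⌊cΔ⌋` (its INTERPOLATION DEGREE is `O(Δ)`), which Philippon's
descent supplies through Chardin–Philippon regularity ("Régularité et interpolation", J. Algebraic
Geom. 8 (1999) 471–481 + erratum 11 (2002): the isolated points of `V(f₁, …, f_t)`, `deg fᵢ ≤ Δ`,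
impose independent conditions on forms of degree `≥ t(Δ − 1) + 1`) applied to the cutting forms of
the construction. -/

/-- **`CycleAPIAt t`** — the 0-cycle approximation property with interpolation control in
dimension `t`: for every `ω ∈ ℂᵗ` there is `c = c(t, ω) ≥ 1` such that for all `Y ≥ Δ ≥ c` some
homogeneous unmixed ideal `I ⊂ ℚ[x₀, …, x_t]` of rank `1` (a 0-dimensional `ℚ`-cycle of `ℙᵗ`) has
`deg I ≤ (cΔ)ᵗ`, `h(I) ≤ c Y Δᵗ⁻¹`, `|I(1 : ω)| ≤ exp(−(Δ·h(I) + Y·deg I)/c)`, and every associated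
prime `𝔭` of `I` (a Galois orbit of points) satisfies `H_𝔭(⌊cΔ⌋) = deg 𝔭` (its zeros impose
independent conditions on the forms of degree `⌊cΔ⌋`). -/
def CycleAPIAt (t : ℕ) : Prop :=
  ∀ ω : Fin t → ℂ, ∃ c : ℝ, 1 ≤ c ∧ ∀ Δ Y : ℝ, c ≤ Δ → Δ ≤ Y →
    ∃ I : Ideal (Rx t), I.IsHomogeneous (homogeneousSubmodule (Fin (t + 1)) ℚ) ∧
      IsUnmixedOfRank I 1 ∧
      (ideg I 1 : ℝ) ≤ (c * Δ) ^ t ∧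
      iheight I 1 ≤ c * Y * Δ ^ (t - 1) ∧
      iabs I 1 (Fin.cons 1 ω) ≤ Real.exp (-((Δ * iheight I 1 + Y * ideg I 1) / c)) ∧
      ∀ 𝔭 ∈ I.associatedPrimes,
        Module.finrank ℚ ↥(homogeneousSubmodule (Fin (t + 1)) ℚ ⌊c * Δ⌋₊) =
          Module.finrank ℚ ↥(homogeneousSubmodule (Fin (t + 1)) ℚ ⌊c * Δ⌋₊ ⊓ 𝔭.restrictScalars ℚ) +
            ideg 𝔭 1

/-- The input of the line for all dimensions `t ≥ 1`. -/
def CycleAPI : Prop :=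
  ∀ t : ℕ, 1 ≤ t → CycleAPIAt t

/-! ## §2  The lever: the Galois-orbit interpolation determinant (multivariate Lemma A.8) -/

/-- **`OrbitClusterBound`** — conjugate clustering costs `k^{1+1/t}`, paid in the INTERPOLATION
degree. For every `t ≥ 1` there are `c₀ = c₀(t) > 0`, `C = C(t) > 0` such that: if `K` is a
number field, `β ∈ Kᵗ`, and the monomials of total degree `≤ δ` in `β` SPAN `K` over `ℚ` (so
`K = ℚ(β)`; `δ` = interpolation degree of the orbit of `(1 : β)`), and `k` DISTINCT complex
embeddings of `K` put `σᵢ(β)` in the sup-ball of radius `r ≤ 1` about `x ∈ ℂᵗ`, then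
`(c₀ k^{1+1/t} − k) · log(1/r) ≤ C · (δ · h_K(1 : β) + D log(D+1) + k δ log(2 + ‖x‖) + k log(δ+2))`,
`D = [K : ℚ]`, `h_K = [K:ℚ] ×` absolute logarithmic Weil height (Mathlib's `Height.logHeight`
relative to `K`). Proof sketch (card + TRIAGE-r1-1/2/3, re-derived by this seat for all `t`):
`V = (σ(mⱼ(β)))_{σ,j}` for a monomial `ℚ`-basis `m₁, …, m_D` of `K` has `det V² = discr ∈ ℚˣ`
(`Algebra.discr_not_zero_of_basis`); product formula + ultrametric Hadamard at the finite places
give `log |det V| ≥ −δ·t·h_K(1:β)`; the EXACT Taylor expansion of the `k` clustered rows at `x` and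
multilinearity kill repeated multi-indices, so `|det V| ≤ N_δ^k · r^{Σord(k)} · (Hadamard)` with
`Σord(k) ≥ k^{1+1/t}/4 − k` (multi-indices fill by total degree; `#{|α| < s} ≤ sᵗ`) and
`N_δ ≤ (δ+1)ᵗ`; `c₀ = 1/4`, `C = 2t` should do. The `t = 1` case is Mahler 1964 / Diaz 1997 (tree:
`Literature.NumberTheory.DiophantineApproximation.norm_sub_root_pow_le`). Vacuous for `k ≤ 4ᵗ`
(left side `≤ 0`), as intended: clusters of bounded size cost a constant. -/
def OrbitClusterBound : Prop :=
  ∀ t : ℕ, 1 ≤ t → ∃ c₀ : ℝ, 0 < c₀ ∧ ∃ C : ℝ, 0 < C ∧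
    ∀ (K : Type) [Field K] [NumberField K] (β : Fin t → K) (δ k : ℕ) (σ : Fin k → (K →+* ℂ))
      (x : Fin t → ℂ) (r : ℝ),
      (∀ z : K, ∃ Q : MvPolynomial (Fin t) ℚ, Q.totalDegree ≤ δ ∧ MvPolynomial.aeval β Q = z) →
      Function.Injective σ → 0 < r → r ≤ 1 →
      (∀ i, ‖(fun j => σ i (β j)) - x‖ ≤ r) →
      (c₀ * (k : ℝ) ^ (1 + 1 / (t : ℝ)) - k) * Real.log (1 / r) ≤
        C * (δ * Height.logHeight (Fin.cons (1 : K) β : Fin (t + 1) → K) +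
          Module.finrank ℚ K * Real.log (Module.finrank ℚ K + 1) +
          k * δ * Real.log (2 + ‖x‖) + k * Real.log ((δ : ℝ) + 2))

/-! ## §3  The transfer `C⁺`: a sharp closest-point property for 0-dimensional primes -/

/-- **`SharpClosestPoint`** (the card's transfer `C⁺`, in the tree's elimination language; compare
the PROVED average form `NesterenkoPhilippon2001_ch3_prop_4_13` at `r = 1`:
`‖ω̄ − β̄‖^{deg 𝔭} ≤ |𝔭(ω̄)| e^{h(𝔭)} e^{4m³ deg 𝔭}`). For every `m ≥ 1` there are `C = C(m) > 0`
(INDEPENDENT of `ℓ`) and `ℓ₀`, and for every `ℓ ≥ ℓ₀` a constant `C' = C'(m, ℓ)`, such that: for a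
homogeneous prime `𝔭 ⊂ ℚ[x₀, …, x_m]` of rank `1` (a Galois orbit of points of `ℙᵐ`) whose zeros
impose independent conditions on the forms of degree `δ` (`H_𝔭(δ) = deg 𝔭`) and an affine point
`ω̄ = (1 : ω)`, some zero `β̄` of `𝔭` satisfies
`‖ω̄ − β̄‖^ℓ ≤ |𝔭(ω̄)| · exp(C δ h(𝔭)/ℓ^{1/m} + C' deg 𝔭 ((δ+1)(log(2+‖ω‖) + 1) + log(deg 𝔭 + 1)))`
— the exponent `deg 𝔭` on the distance (the AVERAGE over the conjugates) replaced by the CONSTANT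
`ℓ` (the SHARE of the nearest conjugate), at the price `δ h(𝔭)/ℓ^{1/m}` (the `k^{1+1/m}` tail of
`OrbitClusterBound`) plus terms linear in `deg 𝔭`. Exponentiated form: `|𝔭(ω̄)| = 0` forces a zero
at projective distance `0`, no `log 0` junk; `‖·‖ ≤ 2` and `ℓ > deg 𝔭` are paid by `C' ≥ ℓ log 2`. -/
def SharpClosestPoint : Prop :=
  ∀ m : ℕ, 1 ≤ m → ∃ C : ℝ, 0 < C ∧ ∃ ℓ₀ : ℕ, ∀ ℓ : ℕ, ℓ₀ ≤ ℓ → ∃ C' : ℝ, 0 < C' ∧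
    ∀ (𝔭 : Ideal (Rx m)) (δ : ℕ) (ω : Fin m → ℂ), 𝔭.IsPrime →
      𝔭.IsHomogeneous (homogeneousSubmodule (Fin (m + 1)) ℚ) → IsUnmixedOfRank 𝔭 1 →
      Module.finrank ℚ ↥(homogeneousSubmodule (Fin (m + 1)) ℚ δ) =
        Module.finrank ℚ ↥(homogeneousSubmodule (Fin (m + 1)) ℚ δ ⊓ 𝔭.restrictScalars ℚ) +
          ideg 𝔭 1 →
      ∃ β ∈ projZeros 𝔭,
        projDist (Fin.cons 1 ω) β ^ ℓ ≤
          iabs 𝔭 1 (Fin.cons 1 ω) *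
            Real.exp (C * δ * iheight 𝔭 1 / (ℓ : ℝ) ^ (1 / (m : ℝ)) +
              C' * ideg 𝔭 1 *
                ((δ + 1) * (Real.log (2 + ‖ω‖) + 1) + Real.log ((ideg 𝔭 1 : ℝ) + 1)))

/-! ## §3b  The 0-dimensional dictionary (lead's reshape: shared by stubs 4 and 5, registered as its own stub) -/

/-- **`ZeroDimDictionary`** — the structure of a homogeneous PRIME `𝔭 ⊂ ℚ[x₀, …, x_m]` of rank `1`
(a Galois orbit of points of `ℙᵐ`) in Nesterenko's language, with one constant `c = c(m)`: there are a
number field `K` and `b ∈ K^{m+1} ∖ 0` (`K = ℚ(b)` the field of the point, `b` any representative)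
such that (A) the projective zeros of `𝔭` are exactly the non-zero multiples of the conjugates
`σ ∘ b`, `σ : K →+* ℂ`; (B′) distinct embeddings give distinct projective points; (B)
`[K : ℚ] = deg 𝔭`; (C) `h_K(b) ≤ h(𝔭) + c·deg 𝔭` (Weil height of the point vs height of the Chow form
`F = a ∏_σ ⟨σb, u⟩`: Gauss's lemma at finite places, Gelfond–Mahler at the archimedean one — tree
`Roy2013.sum_mul_logHeight_le'`, `NguyenRoy.logHeight_comp_div_finrank`); (D)
`|𝔭(ω̄)| ≥ e^{−c deg 𝔭} ∏_σ ‖ω̄ − σb‖` (`ϰ(F) = a ∏_σ M_σ(s)` with `|M_σ| = ‖ω̄ − σb‖·|ω̄|·|σb|`,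
Gelfond's lower bound for the product — tree `sum_log_maxNorm_le` — and `|F| ≤ (m+1)^{deg} |a| ∏|σb|`);
(E) in the chart `b₀ ≠ 0`: if the zeros of `𝔭` impose independent conditions on the forms of degree
`δ` (`H_𝔭(δ) = deg 𝔭`) then the monomials of degree `≤ δ` in the affine coordinates `bⱼ/b₀` span `K`
over `ℚ` (evaluation `ℚ[x]_δ → K` has kernel `𝔭_δ` because `𝔭` is the cone ideal of its point, tree
`PhilipponMain.eq_coneIdeal_of_rank_one`). Sources: LNM 1752 Ch. 3 §4 (Prop. 4.4, property 3 of
`|I(ω̄)|`), Ch. 7 §4.3; Philippon 1986 §1. -/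
def ZeroDimDictionary : Prop :=
  ∀ m : ℕ, 1 ≤ m → ∃ c : ℝ, 0 < c ∧
    ∀ 𝔭 : Ideal (Rx m), 𝔭.IsPrime → 𝔭.IsHomogeneous (homogeneousSubmodule (Fin (m + 1)) ℚ) →
      IsUnmixedOfRank 𝔭 1 →
      ∃ (K : Type) (_ : Field K) (_ : NumberField K) (b : Fin (m + 1) → K), b ≠ 0 ∧
        (∀ β : Fin (m + 1) → ℂ, β ∈ projZeros 𝔭 ↔
          β ≠ 0 ∧ ∃ (σ : K →+* ℂ) (l : ℂ), β = fun j => l * σ (b j)) ∧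
        (∀ (σ τ : K →+* ℂ) (l : ℂ), (fun j => σ (b j)) = (fun j => l * τ (b j)) → σ = τ) ∧
        Module.finrank ℚ K = ideg 𝔭 1 ∧
        Height.logHeight b ≤ iheight 𝔭 1 + c * ideg 𝔭 1 ∧
        (∀ ω : Fin (m + 1) → ℂ, ω ≠ 0 →
          Real.exp (-(c * ideg 𝔭 1)) * ∏ σ : K →+* ℂ, projDist ω (fun j => σ (b j)) ≤
            iabs 𝔭 1 ω) ∧
        (b 0 ≠ 0 → ∀ δ : ℕ,
          Module.finrank ℚ ↥(homogeneousSubmodule (Fin (m + 1)) ℚ δ) =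
            Module.finrank ℚ ↥(homogeneousSubmodule (Fin (m + 1)) ℚ δ ⊓ 𝔭.restrictScalars ℚ) +
              ideg 𝔭 1 →
          ∀ z : K, ∃ Q : MvPolynomial (Fin m) ℚ, Q.totalDegree ≤ δ ∧
            MvPolynomial.aeval (fun j : Fin m => b j.succ / b 0) Q = z)

/-! ## §4  Output before lifting: the point approximation property in the Weil currency -/

/-- **`PointAPAbsAt t`** — Philippon's APPROXIMATION PROPERTY 2 at the affine points of `ℂᵗ`, in the
projective currency `(d(α), d(α)·h(1:α))` of LNM 1752 Ch. 4 §4 (the currency TRIAGE-r1-1/2 require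
for the lifting step): for every `ω ∈ ℂᵗ` there is `c ≥ 1` such that for all `Y ≥ Δ ≥ c` there are a
number field `K`, a point `β ∈ Kᵗ` and a complex embedding `σ` of `K` with `[K:ℚ] ≤ (cΔ)ᵗ`,
`h_K(1 : β) ≤ c Y Δᵗ⁻¹` and `‖σ(β) − ω‖_∞ ≤ exp(−(Δ · h_K(1:β) + Y · [K:ℚ])/c)`
(`h_K` = `Height.logHeight` relative to `K` = `[K:ℚ] ×` absolute height; taking `K ⊋ ℚ(β)` only
over-estimates both budgets consistently, so the optimum is `K = ℚ(β)`). -/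
def PointAPAbsAt (t : ℕ) : Prop :=
  ∀ ω : Fin t → ℂ, ∃ c : ℝ, 1 ≤ c ∧ ∀ Δ Y : ℝ, c ≤ Δ → Δ ≤ Y →
    ∃ (K : Type) (_ : Field K) (_ : NumberField K) (β : Fin t → K) (σ : K →+* ℂ),
      (Module.finrank ℚ K : ℝ) ≤ (c * Δ) ^ t ∧
      Height.logHeight (Fin.cons (1 : K) β : Fin (t + 1) → K) ≤ c * Y * Δ ^ (t - 1) ∧
      ‖(fun j => σ (β j)) - ω‖ ≤
        Real.exp (-((Δ * Height.logHeight (Fin.cons (1 : K) β : Fin (t + 1) → K) +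
          Y * Module.finrank ℚ K) / c))

/-- `PointAPAbs` — the point approximation property in the Weil currency in every dimension `t ≥ 1`
(the conjunction of the `PointAPAbsAt t`). -/
def PointAPAbs : Prop :=
  ∀ t : ℕ, 1 ≤ t → PointAPAbsAt t

/-! ## The registered stubs -/

/-- **Stub 1b — `CycleAPIAt t` for `2 ≤ t`** (lead's reshape: the two unstaffed dimension ranges
of the input merged into ONE registered stub; NOT staffed this session). Range `t ∈ {2, 3}`: KNOWN IN
PRINT modulo construction bookkeeping — Philippon's AP1 with `d' = 0` is a theorem for `n ≤ 3`
(LNM 1752 Ch. 4 §4 p. 61; Philippon, J. Number Theory 81 (2000) 234–253 =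
doi:10.1006/jnth.1999.2461, acq-02318 NOT HELD; `n = 2`: also Laurent–Roy 1999 §§5–6); the
interpolation clause is NOT in the printed statement and must be read off the CONSTRUCTION
(successive intersections with forms of degree `O(Δ)` avoiding components; the final orbits are
isolated points of `V(f₁, …, f_t)`, `deg fᵢ = O(Δ)`, hence impose independent conditions in degree
`t·O(Δ)` by Chardin–Philippon 1999) — size L–XL, BLOCKED on acq-02318. Range `t ≥ 4`: OPEN —
Philippon's Approximation Property 1 with `d' = 0` in `ℙⁿ`, `n ≥ 4`, is his CONJECTURE (LNM 1752
Ch. 4 §4 p. 61), with the interpolation clause; the crux's open content is parked HERE, named; the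
lever (stubs 3–4) removes the 0-cycle → point step in every dimension but does not touch the descent
`d' = n → d' = 0`, whose only missing input Philippon (IJNT 7 (2011),
doi:10.1142/s1793042111004502, p. 4) names as an effective lower bound for the arithmetic Hilbert
function (sibling line arithmetic-chardin-philippon, whose stubs 1–3 dock here). Why it might
fail: for `t ≥ 4` it is a strengthening of an open conjecture; for `t ∈ {2,3}` Lemma 0.6 of LNM 1752
Ch. 8 (p. 163) takes irreducible COMPONENTS at each step, which may lie on low-degree hypersurfaces,
and then the clause needs the restart of cards uniform-relative-restart / dirichlet-descent. -/
theorem stub_cycleAPI_two_le : ∀ t : ℕ, 2 ≤ t → CycleAPIAt t := by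
  sorry

/-- **Stub 1a — `CycleAPIAt 1`** (size M; PROVABLE NOW; split off by the lead). In dimension `1` the
0-cycle property with interpolation control is DIRICHLET'S BOX PRINCIPLE: for `ω ∈ ℂ` and
`Y ≥ Δ ≥ c(ω)` pigeonhole gives a non-zero integer form `P(x₀, x₁)` of degree `D = ⌊c₁Δ⌋` and height
`≤ e^{c₁Y}` with `|P(1, ω)| ≤ e^{−c₁²ΔY/2}` (tree: `exists_int_poly_small_value`,
`SiegelLemmaMargin.exists_ne_zero_int_vec_log_norm_le`); `I = (P) ⊂ ℚ[x₀, x₁]` is homogeneous, unmixed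
of rank `1` (principal in a UFD: associated primes = the irreducible factors `(Q)`), `ideg I 1 = deg P`,
`iheight I 1 = h(P) ≤ log(height) ` (rank-1 Chow form of a principal ideal in `ℚ[x₀,x₁]` is `P(u₁₁, −u₁₀)`
up to `ℚˣ`; tree `NesterenkoChowFormHypersurface*`, `PhilipponCriterionPrincipal`), `iabs I 1 (1, ω) ≤
|P(1,ω)|·e^{O(D)}/(|P|·‖(1,ω)‖^D)`; the accuracy is OUTPUT-dependent for free because the actual degree and
height are at most the budgets and `D_budget · log H_budget ≥ (Δ·h + Y·deg)/c`; the interpolation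
clause for an associated prime `(Q)`, `deg Q ≤ D ≤ ⌊cΔ⌋`: the Hilbert function of `ℚ[x₀,x₁]/(Q)` in
degree `δ ≥ deg Q − 1` is `deg Q` (forms of degree `δ` divisible by `Q` have dimension `δ − deg Q + 1`).
Why it might fail: only bookkeeping against the tree's `ideg/iheight/iabs` of a principal ideal. -/
theorem stub_cycleAPI_one : CycleAPIAt 1 := by
  sorry

/-- **Stub 3 — THE LEVER `OrbitClusterBound`** (size L; provable now; the stub the lead should
HOLD). See the docstring of `OrbitClusterBound` for the four-step proof; ingredients: Mathlib
`Algebra.discr`, `Algebra.discr_not_zero_of_basis`, `Algebra.discr_eq_det_embeddingsMatrixReindex_pow_two`,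
`Matrix.det_le` / tree `Literature.Analysis.Matrix.norm_det_sq_le_of_entry_le` (Hadamard),
`Height.logHeight` over number fields (`NumberField.instAdmissibleAbsValues`, product formula),
multilinearity of `Matrix.det` in rows. Why it might fail: only through a bookkeeping slip in the
finite-place lower bound (a crude common denominator loses a factor `deg`, TRIAGE-r1-1) — the
statement uses `h_K(1:β)`, which is what the place-by-place ultrametric Hadamard bound gives.
Checked against the stress families of TRIAGE-r1-1/2/3 (`(qX−p)^m + 1`, tensor of cluster fields,
`(pⱼ + ζ^{eⱼ})/q`) and kit job j008979 (ideator): no violation, `k^{1+1/t}` is the right order. -/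
theorem stub_orbitClusterBound : OrbitClusterBound := by
  sorry

/-- **Stub 3b — `ZeroDimDictionary`** (size L; PROVABLE NOW; registered by the lead so that stubs
4 and 5 consume ONE proved dictionary instead of each re-deriving it). Ingredients (all in tree):
`NesterenkoChowFormPrime` (`prime_chowForm`, `isPrincipal_elimIdeal`, `trdeg_adjoin_ratio_eq`),
`NesterenkoEliminationZeros*` / `aeval_chowForm_eq_zero_iff` (zeros of the Chow form),
`NesterenkoFormsOnHyperplanes.exists_eq_C_mul_prod_linC` (a form vanishing exactly on the hyperplanes
dual to finitely many points is `C · ∏` linear forms), `NesterenkoUResultantPointwise` (the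
`u`-resultant identity for rank-1 primes), `PhilipponCriterionRankOne.eq_coneIdeal_of_rank_one`,
`NesterenkoEliminationProp47ValuesProofs.sum_log_maxNorm_le` (Gelfond),
`Roy2013.sum_mul_logHeight_le'` (Gelfond–Mahler for linear factors, any finite variable type),
`NguyenRoy.logHeight_comp_div_finrank` (field independence of the absolute height),
`NesterenkoIntegerHeights` (`height` of a rational polynomial = `log max |coeff|` of its primitive
integer multiple), Mathlib `NumberField.Embeddings.card`, `Height.logHeight_smul_eq_logHeight`.
Why it might fail: only if a constant were not linear in `deg 𝔭` (they are: Gelfond's inequality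
for `deg 𝔭` linear factors in `m(m+1)/2` variables; `#supp F ≤ (m+1)^{deg}`). -/
theorem stub_zeroDimDictionary : ZeroDimDictionary := by
  sorry

/-- **Stub 4 — the `ℓ`-extraction: `OrbitClusterBound → ZeroDimDictionary → SharpClosestPoint`**
(size L: real analysis over the dictionary, which is now a HYPOTHESIS — stub 3b). Given a rank-1 homogeneous prime `𝔭` with
`H_𝔭(δ) = deg 𝔭 =: D` and `ω̄ = (1 : ω)`: (i) DICTIONARY (LNM 1752 Ch. 3 §4 property 3 / Ch. 7
§4.3; tree: `PhilipponMain.eq_coneIdeal_of_rank_one`, `Nesterenko.aeval_chowForm_eq_zero_iff`,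
`exists_eq_C_mul_prod_linC`, Gelfond `sum_log_maxNorm_le`, Roy2013 `sum_mul_height_le_log_length`):
`V(𝔭)` is the orbit `{(1 : σb)}` of one affine algebraic point `b`, `K = ℚ(b)`, `[K:ℚ] = D`, the
Chow form is `∏_σ ℓ_{(1:σb)}` up to `ℚˣ`, so `|𝔭(ω̄)| ≥ e^{−c_m D} ∏_σ ‖ω̄ − (1:σb)‖`,
`h_K(1:b) ≤ h(𝔭) + (m+1)D`, and `H_𝔭(δ) = D` iff the monomials of degree `≤ δ` in `b` span `K`;
(ii) order the conjugates by projective distance `ρ₁ ≤ ρ₂ ≤ …`; conjugates with `ρ_k ≥ 1/(8‖ω̄‖²)`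
cost `log(8‖ω̄‖²)` each; the others are affine-near (`affine_near_of_projDist_le`, radius
`r_k ≤ 2‖ω̄‖²ρ_k`), so `OrbitClusterBound` at `x = ω` gives, for `k ≥ ℓ₀ := ⌈(2/c₀)ᵗ⌉ + 1`,
`log(1/ρ_k) ≤ log(2‖ω̄‖²) + (2/c₀)(A k^{−1−1/m} + B)`, `A = C(δ h_K + D log(D+1))`,
`B = C(δ log(2+‖ω‖) + log(δ+2))`; (iii) sum over `k > ℓ` (`Σ_{k>ℓ} k^{−1−1/m} ≤ m ℓ^{−1/m}`, the
`B`-terms crudely `× D`): `∏_{k>ℓ} ρ_k ≥ exp(−C″(δ h(𝔭)/ℓ^{1/m} + D((δ+1)(log(2+‖ω‖)+1) + log(D+1))))`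
with the `ℓ`-free constant `C″ = 4mC/c₀` on the first term, and `ρ₁^ℓ ≤ ∏_{k≤ℓ} ρ_k` (or
`≤ 2^ℓ ∏ ρ` when `ℓ > D`, paid by `C' ≥ ℓ log 2`). Why it might fail: only if the dictionary
constants were not linear in `D` (they are: Gelfond's inequality for `D` linear factors in
`m(m+1)/2` variables). -/
theorem stub_sharpClosestPoint : OrbitClusterBound → ZeroDimDictionary → SharpClosestPoint := by
  sorry

/-- **Stub 5 — pigeonhole and budgets, dimension by dimension:
`ZeroDimDictionary → CycleAPIAt t → SharpClosestPoint → PointAPAbsAt t`** (size M–L; sliced by the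
lead — the proof at dimension `t` only ever used the cycle property at `t`; the output half of the
dictionary is now the HYPOTHESIS `ZeroDimDictionary`, stub 3b).
For `t ≥ 1`, `ω ∈ ℂᵗ`: constants `c₁` (cycle), `C, ℓ₀` (transfer); FIX
`ℓ := max(ℓ₀, ⌈(8 C c₁² (t²+1))ᵗ⌉)` (makes the `δ h(𝔭)/ℓ^{1/t}` tail `≤` share/4), then `C'(ℓ)`, then
the height-scale boost `λ := 8c₁²(t²+1) C' (2 log(2+‖ω‖) + 2 + t)` (makes the `D·Δ` terms `≤`
share/4; allowed because it only multiplies the crux's constant — Disproof §2's `log⁺‖θ‖`), then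
`c`. Run `CycleAPIAt t` at `(Δ, λY)`; take a minimal primary decomposition (Lasker, Mathlib) and the
PROVED `NesterenkoPhilippon2001_ch3_prop_4_7` (degrees, heights, values split over the associated
primes WITH exponents `k_j`); pigeonhole with weights `k_j(Δ h(𝔭_j) + λY deg 𝔭_j)` — multiplicities
cancel — gives a component `𝔭` with `|𝔭(ω̄)| ≤ exp(−(Δ h(𝔭) + λ Y D)/(2c₁(t²+1)))` once `Y ≥ 2c₁t³`;
`SharpClosestPoint` with `δ = ⌊c₁Δ⌋` (the interpolation clause) yields a zero at
`log(1/ρ) ≥ (Δ h(𝔭) + Y D)/(4 c₁ ℓ (t²+1))`; `affine_near_of_projDist_le` (tree) and the output half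
of the dictionary (`[ℚ(b):ℚ] ≤ D ≤ (c₁Δ)ᵗ`, `h_K(1:b) ≤ h(𝔭) + (t+1)D ≤ h(I) + t² deg I + (t+1) deg I
≤ c Y Δᵗ⁻¹` using `Y ≥ Δ`) give `PointAPAbs` with `c = O(c₁ ℓ λ t²)`. Why it might fail: it does not
at truth level given stubs 1–4 (numerology re-derived by this seat and by TRIAGE-r1-1/2); the
formalisation risk is the 0-dimensional dictionary shared with stub 4. -/
theorem stub_pointAP :
    ∀ t : ℕ, 1 ≤ t → ZeroDimDictionary → CycleAPIAt t → SharpClosestPoint → PointAPAbsAt t := by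
  sorry

/-- **Stub 6 — lifting and currency, sliced: `(∀ t₀ ∈ [1, t], PointAPAbsAt t₀) → PointwiseAPSlice t`**
(size L; provable now; sliced by the lead — the lifting at exponent `t` applies the point property at
`t₀ = trdeg ℚ(θ) ≤ t` only; this is
`LiftingStep` done "from `(d(α), h(1:α))`" as TRIAGE-r1-1 §3 / r1-2 demand, NOT the refutable
per-coordinate `APAt θ t → APAt (η, θ) t`). Given `θ : ι → ℂ` with `trdeg ℚ(θ) = t₀ ≤ t`, `t ≥ 1`:
`t₀ = 0` ⇒ all coordinates algebraic, take `γ = θ` (Disproof §4 `apAt_of_forall_isAlgebraic`,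
re-proved); else choose a transcendence basis `ω` among the coordinates (Mathlib
`exists_isTranscendenceBasis_subset`-type), apply `PointAPAbs t₀ ω` to get `(K, β, σ)`, lift every
other coordinate `η` as the nearest root of its (separable) minimal polynomial `F_η(ω; y)` over
`ℤ[ω]` at `σ(β)` (implicit function / Rouché: `|η' − η| ≤ L_θ ‖σβ − ω‖` once `‖σβ − ω‖ ≤ r_θ`,
guaranteed for `Y ≥ c(θ)`), so `γ = (σβ, η') ∈ ℚ̄^ι` generates a field of degree
`d ≤ [K:ℚ] ∏ deg_y F_η ≤ e_θ (cΔ)^{t₀}`; naive heights: `log H(βⱼ) ≤ h_K(1:β) + [K:ℚ] log 2`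
(Mahler measure vs. Weil height, tree `QuadraticRelationsLogarithmsMahlerWeil`/`Bugeaud2004` tools)
and `log H(η') ≤ C_θ (h_K(1:β) + [K:ℚ])`; with `Δ ≤ Y` every budget and the accuracy
`exp(−(log H·Δ + d·Y)/c')` follow with `c' = c'(θ)`, and `t₀ ≤ t` by monotonicity of the budgets
(Disproof §0 `apWith_mono`). Why it might fail: it does not at truth level; `1 ≤ t` is used exactly
where Disproof §1 says it must be. -/
theorem stub_lift :
    ∀ t : ℕ, 1 ≤ t → (∀ t₀ : ℕ, 1 ≤ t₀ → t₀ ≤ t → PointAPAbsAt t₀) → PointwiseAPSlice t := by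
  sorry

/-! ## The composition (kernel-checked; no `sorry` outside the stubs) -/

/-- The two dimension ranges of the input glue to `CycleAPI`. -/
theorem cycleAPI_of (h₁ : CycleAPIAt 1) (h₂ : ∀ t : ℕ, 2 ≤ t → CycleAPIAt t) : CycleAPI :=
  fun t ht => if h1 : t = 1 then h1 ▸ h₁ else h₂ t (by omega)

/-- Cycle input at every `t₀ ≤ t` + dictionary + transfer + pigeonhole + lifting ⟹ the slice at `t`
(kernel-checked glue of the sliced stubs; used with `t = 1` in `slice_one_of`). -/
theorem slice_of (t : ℕ) (ht : 1 ≤ t) (hcyc : ∀ t₀ : ℕ, 1 ≤ t₀ → t₀ ≤ t → CycleAPIAt t₀)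
    (hdict : ZeroDimDictionary) (hsharp : SharpClosestPoint)
    (hpt : ∀ t₀ : ℕ, 1 ≤ t₀ → ZeroDimDictionary → CycleAPIAt t₀ → SharpClosestPoint →
      PointAPAbsAt t₀)
    (hlift : ∀ t : ℕ, 1 ≤ t → (∀ t₀ : ℕ, 1 ≤ t₀ → t₀ ≤ t → PointAPAbsAt t₀) → PointwiseAPSlice t) :
    PointwiseAPSlice t :=
  hlift t ht fun t₀ h₀ h₀t => hpt t₀ h₀ hdict (hcyc t₀ h₀ h₀t) hsharp

/-- **The crux from the line** — the ONLY theorem of this file concluding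
`Summit.Schanuel.Schanuel.Theses.DiophantineDichotomy.ApproximationProperty`, BY NAME; no
hypotheses: the seven registered stubs are invoked. Chain: (stubs 1a, 1b ⟹ `CycleAPI`),
stub 3b (dictionary) and (stub 3 ⟹ stub 4 ⟹ `SharpClosestPoint`) feed stub 5 ⟹ `PointAPAbsAt t₀`
for all `t₀` ⟹ stub 6 ⟹ every `PointwiseAPSlice t` ⟹ `PointwiseAP` (`pointwiseAP_iff_slice`), which
is the crux verbatim (`pointwiseAP_iff`, `Iff.rfl`). -/
theorem ApproximationProperty_of : ApproximationProperty :=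
  pointwiseAP_iff.mp <| pointwiseAP_iff_slice.mpr fun t ht =>
    slice_of t ht (fun t₀ h₀ _ => cycleAPI_of stub_cycleAPI_one stub_cycleAPI_two_le t₀ h₀)
      stub_zeroDimDictionary
      (stub_sharpClosestPoint stub_orbitClusterBound stub_zeroDimDictionary) stub_pointAP stub_lift

/-- **Stand-alone pay-offs (kernel-checked dependencies).** The `t = 1` slice — the route's support
item `ApproximationPropertyDegOne` (stmt-Schanuel-11037), Laurent–Roy 1999 for points of
transcendence degree `1` in `ℂ^ι` — needs only stubs 1a, 3, 3b, 4, 5, 6 (no Philippon 2000, no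
conjecture). -/
theorem slice_one_of (h₁ : CycleAPIAt 1) (h₃ : OrbitClusterBound) (hd : ZeroDimDictionary)
    (h₄ : OrbitClusterBound → ZeroDimDictionary → SharpClosestPoint)
    (h₅ : ∀ t : ℕ, 1 ≤ t → ZeroDimDictionary → CycleAPIAt t → SharpClosestPoint → PointAPAbsAt t)
    (h₆ : ∀ t : ℕ, 1 ≤ t → (∀ t₀ : ℕ, 1 ≤ t₀ → t₀ ≤ t → PointAPAbsAt t₀) → PointwiseAPSlice t) :
    PointwiseAPSlice 1 :=
  slice_of 1 le_rfl (fun t₀ h₀ h₀1 => by obtain rfl : t₀ = 1 := le_antisymm h₀1 h₀; exact h₁)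
    hd (h₄ h₃ hd) h₅ h₆

/-! ## Sanity (elaboration checks only; no theorem below concludes the crux) -/

/-- `CycleAPI` at `t = 1` is stub 1a, at `t = 4` in stub 1b's range. -/
example (h : CycleAPI) : CycleAPIAt 1 ∧ CycleAPIAt 4 := ⟨h 1 (by norm_num), h 4 (by norm_num)⟩

/-- The conclusion of `stub_lift` contains the route's KNOWN `t = 1` support item
`ApproximationPropertyDegOne` (stmt-Schanuel-11037) as its `t = 1` slice — the same positive glue
as Disproof.lean §0 `degOne_of_approximationProperty`; recorded so the lead can sanity-check stub 6
against the vendored `Bugeaud2004_thm_8_11` instance. -/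
theorem degOne_of_pointwiseAP (h : PointwiseAP) : ApproximationPropertyDegOne := by
  intro ι _ θ hθ
  obtain ⟨c, hc, hall⟩ := h ι θ 1 le_rfl (by simpa using hθ)
  refine ⟨c, hc, fun Δ Y hΔ hY => ?_⟩
  obtain ⟨γ, d, H, h1, h2, h3, h4, h5⟩ := hall Δ Y hΔ hY
  exact ⟨γ, d, H, h1, h2, by simpa using h3, by simpa using h4, h5⟩

/-- The `t = 1` slice is the support item `ApproximationPropertyDegOne` (stmt-Schanuel-11037). -/
theorem degOne_of_slice_one (h : PointwiseAPSlice 1) : ApproximationPropertyDegOne := by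
  intro ι _ θ hθ
  obtain ⟨c, hc, hall⟩ := h ι θ (by simpa using hθ)
  refine ⟨c, hc, fun Δ Y hΔ hY => ?_⟩
  obtain ⟨γ, d, H, h1, h2, h3, h4, h5⟩ := hall Δ Y hΔ hY
  exact ⟨γ, d, H, h1, h2, by simpa using h3, by simpa using h4, h5⟩

end

end Summit.Schanuel.Schanuel.Cruxes.ApproximationProperty.OrbitInterpolationDeterminant
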